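import Summits.QuantumFields.YangMills.Theorems.AllWindowsColdBoxTiltMomentsExp
import Mathlib.Analysis.Convex.Integral
import Mathlib.Analysis.Convex.Mul
import HarnessLib

/-!
# LINE-17 «hypercontractive second-order tilt expansion» on crux `AllWindowsColdBox.BoxMidWindowsSU22` (stmt-QuantumFields-24003):
# the FIRST CLAUSE `(∫ W⁸ dν)^{1/4} ≤ K⌈β^θ⌉⁶/β` of stub E and **`TiltMoments θ` from the cubic-chaos input** (STUB-PLAN-E §2 E(6)+E(8))

Completion of the assembly begun in `…AllWindowsColdBoxTiltMomentsExp` (second clause).  Under the same single hypothesis on the cubic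
part `V₃ = tiltCubicW ρ₂ H β` of the tilt — the hypercontractive even-moment bound `∫ V₃^{2k} dγ ≤ (2k−1)^{3k}(K₁(2H+3)⁶/β)^k`, `k ≥ 1`,
with all even powers integrable (E(1)+E(3)+E(5) of STUB-PLAN-E) — this file proves clause (1) and concludes `TiltMoments θ` for every
`0 < θ ≤ 1/16`:

* **`tiltMoments_l8_of_cubic`** (clause 1, `K = 10⁹(K₁+1)`): `W = T − c` (`T = tiltWE`, `c = ∫T dν`), `W⁸ ≤ 2⁷(T⁸ + c⁸)` and Jensen
  `c⁸ ≤ ∫T⁸ dν` (`ConvexOn.map_integral_le`, `T` is bounded on the event hence `ν`-integrable); on the event `|T| ≤ |V₃| + X₂ + X₃`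
  (E(0) + the dominators, as in clause 2), so `T⁸ ≤ 3⁷(V₃⁸ + X₂⁸ + X₃⁸)` `ν`-a.e.; `∫·dν ≤ 2∫·dγ` (`integral_cond_le_two_mul`,
  `γ(E) ≥ 1/2`); hypercontractivity at `k = 4`: `∫X^8 dγ ≤ 7^{4m}s⁴` (`m = 3, 4, 2`); and `s₁ ≤ 15625K₁H⁶/β` (`2H+3 ≤ 5H`),
  `ŝ₂, ŝ₃ ≤ H⁶/β` eventually (`eventually_l8ClauseThresholds`, box-side bookkeeping); finally `(·)^{1/4}` (`Real.pow_rpow_inv_natCast`).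
* **`tiltMoments_of_cubic : (V₃-package) → ∀ θ, 0 < θ → θ ≤ 1/16 → TiltMoments θ`** — so the registered stub
  `stub_tiltMoments : GaussPolyHypercontractivity → DirFreeVarLinear → DirPoincareCubic → ∀ θ, 0 < θ → θ ≤ 1/16 → TiltMoments θ`
  follows BY NAME from the V₃-package alone (B, C enter only through tree lemmas already used; D is not needed).

No definition; standard axioms.  HONEST LABEL: the OPEN registered stub E of one critic-PASSed line on the R2ξ″ RECORD-rung crux 24003,
reduced to its cubic-chaos input (E(1)+E(3)+E(5), sibling seat w5); no stub is proved by name here, no crux, rung or summit is proved;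
the Yang–Mills mass gap is NOT proved by this file.
-/

set_option autoImplicit false

noncomputable section

open MeasureTheory ProbabilityTheory Finset
open Literature.MathematicalPhysics.QuantumLattice
open Literature.MathematicalPhysics.QuantumFieldTheory
open Literature.MathematicalPhysics.QuantumFieldTheory.LatticeMaxwell
open Summit.QuantumFields.YangMills.Theorems.WeakCouplingRates
open Summit.QuantumFields.YangMills.Theorems.ColdBoxAllGroups
open Summit.QuantumFields.YangMills.Theorems.FreeEnergyLogCoefficient

namespace Summit.QuantumFields.YangMills.Theorems.AllWindowsColdBoxBoxMidLine

open Summit.QuantumFields.YangMills.Theorems.AllWindowsColdBox.CappedExpMoment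

/-! ## Elementary power-mean inequalities -/

/-- `(x + y)⁸ ≤ 2⁷(x⁸ + y⁸)` for `x, y ≥ 0`. -/
theorem add_pow_eight_le {x y : ℝ} (hx : 0 ≤ x) (hy : 0 ≤ y) : (x + y) ^ 8 ≤ 2 ^ 7 * (x ^ 8 + y ^ 8) := by
  have h := pow_sum_le_card_mul_sum_pow (s := (Finset.univ : Finset (Fin 2))) (f := ![x, y])
    (fun i _ => by fin_cases i <;> simp [hx, hy]) 7
  simpa [Fin.sum_univ_two] using h

/-- `(x + y + z)⁸ ≤ 3⁷(x⁸ + y⁸ + z⁸)` for `x, y, z ≥ 0`. -/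
theorem add_add_pow_eight_le {x y z : ℝ} (hx : 0 ≤ x) (hy : 0 ≤ y) (hz : 0 ≤ z) :
    (x + y + z) ^ 8 ≤ 3 ^ 7 * (x ^ 8 + y ^ 8 + z ^ 8) := by
  have h := pow_sum_le_card_mul_sum_pow (s := (Finset.univ : Finset (Fin 3))) (f := ![x, y, z])
    (fun i _ => by fin_cases i <;> simp [hx, hy, hz]) 7
  simpa [Fin.sum_univ_three, add_assoc] using h

/-- `(a − b)⁸ ≤ 2⁷(a⁸ + b⁸)`. -/
theorem sub_pow_eight_le (a b : ℝ) : (a - b) ^ 8 ≤ 2 ^ 7 * (a ^ 8 + b ^ 8) := by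
  have h8 : Even 8 := by decide
  have h1 : (a - b) ^ 8 ≤ (|a| + |b|) ^ 8 := by
    rw [← h8.pow_abs (a - b)]
    exact pow_le_pow_left₀ (abs_nonneg _) (abs_sub _ _) 8
  have h2 := add_pow_eight_le (abs_nonneg a) (abs_nonneg b)
  rw [h8.pow_abs a, h8.pow_abs b] at h2
  exact h1.trans h2

/-! ## The thresholds of the first clause -/

/-- `s₁ = K₁(2H+3)⁶/β ≤ 15625K₁·H⁶/β` for `H ≥ 1` (`2H+3 ≤ 5H`). -/
theorem sOne_le {β Hr K₁ : ℝ} (hβ : 0 < β) (hK : 0 ≤ K₁) (hH1 : 1 ≤ Hr) :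
    K₁ * (2 * Hr + 3) ^ 6 / β ≤ 15625 * K₁ * (Hr ^ 6 / β) := by
  have hS6 : (2 * Hr + 3) ^ 6 ≤ (5 * Hr) ^ 6 := pow_le_pow_left₀ (by linarith) (by linarith) 6
  rw [mul_assoc, ← mul_div_assoc, ← mul_div_assoc]
  refine div_le_div_of_nonneg_right ?_ hβ.le
  calc K₁ * (2 * Hr + 3) ^ 6 ≤ K₁ * (5 * Hr) ^ 6 := mul_le_mul_of_nonneg_left hS6 hK
    _ = 15625 * (K₁ * Hr ^ 6) := by ring

/-- Real algebra of the first clause: `ŝ₂, ŝ₃ ≤ H⁶/β` from two monomials and `S = 2H+3 ≤ 5H`. -/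
theorem l8_algebra {D S β NE Hr C₂ : ℝ} (hβ : 0 < β) (hH1 : 1 ≤ Hr) (hS : S = 2 * Hr + 3)
    (hNE0 : 0 ≤ NE) (hNE : NE ≤ 4 * S ^ 4)
    (m9 : (13440 ^ 2 * 105 * 4 ^ 2 * 8 ^ 4) * 5 ^ 6 * (D ^ 4 * S ^ 6 * β⁻¹) ≤ 1)
    (m10 : (2 ^ 2 * 3 * 4 ^ 2 * 8 ^ 2) * 5 ^ 6 * (C₂ ^ 2 * D ^ 2 * S ^ 4 * β⁻¹) ≤ 1) :
    (13440 * β) ^ 2 * (105 * D ^ 4 * NE ^ 2 * (16 * Hr) ^ 4 / β ^ 4) ≤ Hr ^ 6 / β ∧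
    (2 * C₂) ^ 2 * (3 * D ^ 2 * NE ^ 2 * (16 * Hr) ^ 2 / β ^ 2) ≤ Hr ^ 6 / β := by
  have hH0 : 0 ≤ Hr := by linarith
  have hS0 : 0 ≤ S := by rw [hS]; linarith
  have hS6 : S ^ 6 ≤ 5 ^ 6 * Hr ^ 6 := by
    rw [← mul_pow]; exact pow_le_pow_left₀ hS0 (by rw [hS]; linarith) 6
  have h16 : 16 * Hr ≤ 8 * S := by rw [hS]; linarith
  have h16' : 0 ≤ 16 * Hr := by positivity
  refine ⟨?_, ?_⟩
  · calc (13440 * β) ^ 2 * (105 * D ^ 4 * NE ^ 2 * (16 * Hr) ^ 4 / β ^ 4)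
        ≤ (13440 * β) ^ 2 * (105 * D ^ 4 * (4 * S ^ 4) ^ 2 * (8 * S) ^ 4 / β ^ 4) := by gcongr
      _ = (13440 ^ 2 * 105 * 4 ^ 2 * 8 ^ 4) * (D ^ 4 * S ^ 6 * β⁻¹) * (S ^ 6 / β) := by field_simp
      _ ≤ (13440 ^ 2 * 105 * 4 ^ 2 * 8 ^ 4) * (D ^ 4 * S ^ 6 * β⁻¹) * (5 ^ 6 * Hr ^ 6 / β) := by
          have : 0 ≤ (13440 ^ 2 * 105 * 4 ^ 2 * 8 ^ 4) * (D ^ 4 * S ^ 6 * β⁻¹) := by positivity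
          exact mul_le_mul_of_nonneg_left (div_le_div_of_nonneg_right hS6 hβ.le) this
      _ = (13440 ^ 2 * 105 * 4 ^ 2 * 8 ^ 4) * 5 ^ 6 * (D ^ 4 * S ^ 6 * β⁻¹) * (Hr ^ 6 / β) := by ring
      _ ≤ 1 * (Hr ^ 6 / β) := mul_le_mul_of_nonneg_right m9 (by positivity)
      _ = Hr ^ 6 / β := one_mul _
  · calc (2 * C₂) ^ 2 * (3 * D ^ 2 * NE ^ 2 * (16 * Hr) ^ 2 / β ^ 2)
        ≤ (2 * C₂) ^ 2 * (3 * D ^ 2 * (4 * S ^ 4) ^ 2 * (8 * S) ^ 2 / β ^ 2) := by gcongr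
      _ = (2 ^ 2 * 3 * 4 ^ 2 * 8 ^ 2) * (C₂ ^ 2 * D ^ 2 * S ^ 4 * β⁻¹) * (S ^ 6 / β) := by field_simp
      _ ≤ (2 ^ 2 * 3 * 4 ^ 2 * 8 ^ 2) * (C₂ ^ 2 * D ^ 2 * S ^ 4 * β⁻¹) * (5 ^ 6 * Hr ^ 6 / β) := by
          have : 0 ≤ (2 ^ 2 * 3 * 4 ^ 2 * 8 ^ 2) * (C₂ ^ 2 * D ^ 2 * S ^ 4 * β⁻¹) := by positivity
          exact mul_le_mul_of_nonneg_left (div_le_div_of_nonneg_right hS6 hβ.le) this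
      _ = (2 ^ 2 * 3 * 4 ^ 2 * 8 ^ 2) * 5 ^ 6 * (C₂ ^ 2 * D ^ 2 * S ^ 4 * β⁻¹) * (Hr ^ 6 / β) := by ring
      _ ≤ 1 * (Hr ^ 6 / β) := mul_le_mul_of_nonneg_right m10 (by positivity)
      _ = Hr ^ 6 / β := one_mul _

/-- **The thresholds of the first clause, eventually in `β`** (`0 < θ ≤ 1/16`): `β ≥ 1`, `ŝ₂ ≤ H⁶/β`, `ŝ₃ ≤ H⁶/β` (`H = ⌈β^θ⌉`). -/
theorem eventually_l8ClauseThresholds {θ : ℝ} (hθ : 0 < θ) (hθ16 : θ ≤ 1 / 16) (C₂ : ℝ) :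
    ∃ β₀ : ℝ, ∀ β : ℝ, β₀ ≤ β → 1 ≤ β ∧
      (13440 * β) ^ 2 * (105 * (dimE ρ₂ : ℝ) ^ 4 * (Fintype.card (ColdFreeIdx ⌈β ^ θ⌉₊) : ℝ) ^ 2 *
          (16 * (⌈β ^ θ⌉₊ : ℝ)) ^ 4 / β ^ 4) ≤ (⌈β ^ θ⌉₊ : ℝ) ^ 6 / β ∧
      (2 * C₂) ^ 2 * (3 * (dimE ρ₂ : ℝ) ^ 2 * (Fintype.card (ColdFreeIdx ⌈β ^ θ⌉₊) : ℝ) ^ 2 *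
          (16 * (⌈β ^ θ⌉₊ : ℝ)) ^ 2 / β ^ 2) ≤ (⌈β ^ θ⌉₊ : ℝ) ^ 6 / β := by
  obtain ⟨b₁, hb₁1, m9⟩ := eventually_monomial_le_one ((13440 ^ 2 * 105 * 4 ^ 2 * 8 ^ 4) * 5 ^ 6 * (dimE ρ₂ : ℝ) ^ 4) 6 hθ
    (a := -1) (by push_cast; linarith)
  obtain ⟨b₂, -, m10⟩ := eventually_monomial_le_one ((2 ^ 2 * 3 * 4 ^ 2 * 8 ^ 2) * 5 ^ 6 * (C₂ ^ 2 * (dimE ρ₂ : ℝ) ^ 2)) 4 hθ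
    (a := -1) (by push_cast; linarith)
  refine ⟨max b₁ b₂, fun β hβ => ?_⟩
  have hβ₁ : b₁ ≤ β := (le_max_left _ _).trans hβ
  have hβ₂ : b₂ ≤ β := (le_max_right _ _).trans hβ
  have hβ1 : 1 ≤ β := hb₁1.trans hβ₁
  have hβ0 : 0 < β := by linarith
  have hHr : (1 : ℝ) ≤ (⌈β ^ θ⌉₊ : ℝ) := (one_le_ceil_rpow_and_le hβ1 hθ.le).1
  obtain ⟨-, hNE, -⟩ := boxSide_facts ⌈β ^ θ⌉₊
  have hi1 : β⁻¹ = β ^ (-1 : ℝ) := (Real.rpow_neg_one β).symm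
  have m9' : (13440 ^ 2 * 105 * 4 ^ 2 * 8 ^ 4) * 5 ^ 6 * ((dimE ρ₂ : ℝ) ^ 4 * (2 * (⌈β ^ θ⌉₊ : ℝ) + 3) ^ 6 * β⁻¹) ≤ 1 := by
    have h := m9 β hβ₁; rw [← hi1] at h; linarith [h]
  have m10' : (2 ^ 2 * 3 * 4 ^ 2 * 8 ^ 2) * 5 ^ 6 * (C₂ ^ 2 * (dimE ρ₂ : ℝ) ^ 2 * (2 * (⌈β ^ θ⌉₊ : ℝ) + 3) ^ 4 * β⁻¹) ≤ 1 := by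
    have h := m10 β hβ₂; rw [← hi1] at h; linarith [h]
  obtain ⟨h1, h2⟩ := l8_algebra hβ0 hHr rfl (Nat.cast_nonneg _) hNE m9' m10'
  exact ⟨hβ1, h1, h2⟩

/-! ## The first clause -/
set_option maxHeartbeats 400000 in
/-- **The FIRST CLAUSE of stub E `stub_tiltMoments` of LINE-17, from the cubic-chaos input alone**: for every `0 < θ ≤ 1/16` and every
admissible chart density there are `K ≥ 0` and `β₀` with `(∫ W⁸ dν)^{1/4} ≤ K·⌈β^θ⌉⁶/β` for `β ≥ β₀`.  Route: `W = T − c` with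
`T = tiltWE`, `c = ∫T dν`; `W⁸ ≤ 2⁷(T⁸ + c⁸)` and Jensen `c⁸ ≤ ∫T⁸dν`; on the event `|T| ≤ |V₃| + X₂ + X₃`, so
`T⁸ ≤ 3⁷(V₃⁸ + X₂⁸ + X₃⁸)` `ν`-a.e.; `∫·dν ≤ 2∫·dγ` (`γ(E) ≥ 1/2`); hypercontractivity at `k = 4` gives `∫X^8dγ ≤ 7^{4m}s⁴`; and
`s₁ ≤ 15625K₁H⁶/β`, `ŝ₂, ŝ₃ ≤ H⁶/β` eventually.  Constant `K = 10⁹·(K₁ + 1)`. -/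
theorem tiltMoments_l8_of_cubic
    (hV : ∃ K₁ : ℝ, 0 ≤ K₁ ∧ ∀ (H : ℕ) (β : ℝ), 1 ≤ H → 1 ≤ β →
      (∀ k : ℕ, 1 ≤ k → ∫ t, tiltCubicW ρ₂ H β t ^ (2 * k) ∂(gaussD H (dimE ρ₂)) ≤
          (2 * k - 1 : ℝ) ^ (k * 3) * (K₁ * (2 * (H : ℝ) + 3) ^ 6 / β) ^ k) ∧
      (∀ k : ℕ, Integrable (fun t => tiltCubicW ρ₂ H β t ^ (2 * k)) (gaussD H (dimE ρ₂))))
    {θ : ℝ} (hθ : 0 < θ) (hθ16 : θ ≤ 1 / 16) {r₂ C₂ : ℝ} {J : EuclideanSpace ℝ (Fin (dimE ρ₂)) → ℝ}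
    (hJ : AdmissibleDensity r₂ C₂ J) :
    ∃ K β₀ : ℝ, 0 ≤ K ∧ ∀ β : ℝ, β₀ ≤ β →
      (∫ t, centredTilt θ β J t ^ 8 ∂(lineGauss θ β)) ^ (1 / 4 : ℝ) ≤ K * (⌈β ^ θ⌉₊ : ℝ) ^ 6 / β := by
  haveI : SecondCountableTopology (Matrix (Fin 2) (Fin 2) ℂ) := inferInstanceAs (SecondCountableTopology (Fin 2 → Fin 2 → ℂ))
  haveI : SecondCountableTopology SU2 := inferInstance
  have hρc : Continuous ρ₂ := continuous_fundamentalRep (Fin 2)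
  have hinj : Function.Injective ρ₂ := fundamentalRep_injective (Fin 2)
  obtain ⟨hr₂, hC₂, hJc, hJb, hJhalf⟩ := hJ
  obtain ⟨K₁, hK₁, hVK⟩ := hV
  obtain ⟨β₁, hpack⟩ := eventually_lineGauss_package hθ hθ16 (k := 1) le_rfl
  obtain ⟨β₂, hthr⟩ := eventually_expClauseThresholds hθ hθ16 hr₂ hC₂.le hK₁
  obtain ⟨β₃, hthr8⟩ := eventually_l8ClauseThresholds hθ hθ16 C₂
  refine ⟨10 ^ 9 * (K₁ + 1), max (max β₁ β₂) β₃, by positivity, fun β hβ => ?_⟩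
  obtain ⟨hβ1, hνP, hγS, -, -, hhalf⟩ := hpack β (le_trans (le_max_left _ _) ((le_max_left _ _).trans hβ))
  obtain ⟨-, hR4, hRr, -, -, -, -, -, -⟩ := hthr β (le_trans (le_max_right _ _) ((le_max_left _ _).trans hβ))
  obtain ⟨-, hŝ₂, hŝ₃⟩ := hthr8 β ((le_max_right _ _).trans hβ)
  have hβ0 : 0 < β := by linarith
  have hHr : (1 : ℝ) ≤ (⌈β ^ θ⌉₊ : ℝ) := (one_le_ceil_rpow_and_le hβ1 hθ.le).1
  have hH : 1 ≤ ⌈β ^ θ⌉₊ := by exact_mod_cast hHr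
  haveI : IsProbabilityMeasure (gaussD ⌈β ^ θ⌉₊ (dimE ρ₂)) := isProbabilityMeasure_gaussD _ _
  haveI : IsProbabilityMeasure (lineGauss θ β) := hνP
  have hSm : MeasurableSet (lineEvent θ β) := measurableSet_lineEvent θ β
  have hR0 : 0 ≤ 2 * etaOf β ⌈β ^ θ⌉₊ (epsOf θ) := by unfold etaOf; positivity
  have hES : ∀ t ∈ lineEvent θ β, ∀ e, ‖unscaleTE ⌈β ^ θ⌉₊ (dimE ρ₂) β t e‖ ≤ 2 * etaOf β ⌈β ^ θ⌉₊ (epsOf θ) :=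
    fun t ht e => ht.2 e
  obtain ⟨hmom₁, hint₁⟩ := hVK ⌈β ^ θ⌉₊ β hH hβ1
  have hs₁ : K₁ * (2 * (⌈β ^ θ⌉₊ : ℝ) + 3) ^ 6 / β ≤ 15625 * K₁ * ((⌈β ^ θ⌉₊ : ℝ) ^ 6 / β) := sOne_le hβ0 hK₁ hHr
  have hu0 : 0 ≤ (⌈β ^ θ⌉₊ : ℝ) ^ 6 / β := by positivity
  have hs₁0 : 0 ≤ K₁ * (2 * (⌈β ^ θ⌉₊ : ℝ) + 3) ^ 6 / β := by positivity
  -- measurability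
  have hX₁m : Measurable (tiltCubicW ρ₂ ⌈β ^ θ⌉₊ β) := measurable_tiltCubicW ρ₂ β
  have hX₂m : Measurable fun t : TSpaceD ⌈β ^ θ⌉₊ (dimE ρ₂) =>
      13440 * β * ∑ e : ColdFreeIdx ⌈β ^ θ⌉₊, ‖unscaleTE ⌈β ^ θ⌉₊ (dimE ρ₂) β t e‖ ^ 4 :=
    (measurable_sum_norm_unscaleTE_pow β 4).const_mul _
  have hX₃m : Measurable fun t : TSpaceD ⌈β ^ θ⌉₊ (dimE ρ₂) =>
      2 * C₂ * ∑ e : ColdFreeIdx ⌈β ^ θ⌉₊, ‖unscaleTE ⌈β ^ θ⌉₊ (dimE ρ₂) β t e‖ ^ 2 :=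
    (measurable_sum_norm_unscaleTE_pow β 2).const_mul _
  have hTm : Measurable (tiltWE ρ₂ ⌈β ^ θ⌉₊ J β) := measurable_tiltWE ρ₂ hρc hinj hJc.measurable β
  -- the pointwise decomposition on the event
  have hdec : ∀ t ∈ lineEvent θ β, |tiltWE ρ₂ ⌈β ^ θ⌉₊ J β t| ≤
      |tiltCubicW ρ₂ ⌈β ^ θ⌉₊ β t| + 13440 * β * ∑ e : ColdFreeIdx ⌈β ^ θ⌉₊, ‖unscaleTE ⌈β ^ θ⌉₊ (dimE ρ₂) β t e‖ ^ 4 +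
        2 * C₂ * ∑ e : ColdFreeIdx ⌈β ^ θ⌉₊, ‖unscaleTE ⌈β ^ θ⌉₊ (dimE ρ₂) β t e‖ ^ 2 := by
    intro t ht
    have h4 : ∀ e, ‖unscaleTE ⌈β ^ θ⌉₊ (dimE ρ₂) β t e‖ ≤ 1 / 4 := fun e => (hES t ht e).trans hR4
    have hr : ∀ e, ‖unscaleTE ⌈β ^ θ⌉₊ (dimE ρ₂) β t e‖ ≤ r₂ := fun e => (hES t ht e).trans hRr
    have h0 := abs_tiltWE_sub_tiltCubicW_sub_log_le ρ₂ hρc hβ0 J t h4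
    have hrem := remainder_le_sum_norm_pow_four hβ0.le t (plaquettesTouching (AxialGauge.boxEdges 4 (2 * ⌈β ^ θ⌉₊ + 1)))
    have hlog := abs_sum_log_le_sum_norm_sq_of_admissible ⟨hr₂, hC₂, hJc, hJb, hJhalf⟩ β t hr
    have htri : |tiltWE ρ₂ ⌈β ^ θ⌉₊ J β t| ≤
        |tiltWE ρ₂ ⌈β ^ θ⌉₊ J β t - tiltCubicW ρ₂ ⌈β ^ θ⌉₊ β t -
            ∑ e : ColdFreeIdx ⌈β ^ θ⌉₊, Real.log (J (unscaleTE ⌈β ^ θ⌉₊ (dimE ρ₂) β t e))| +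
          |tiltCubicW ρ₂ ⌈β ^ θ⌉₊ β t| + |∑ e : ColdFreeIdx ⌈β ^ θ⌉₊, Real.log (J (unscaleTE ⌈β ^ θ⌉₊ (dimE ρ₂) β t e))| := by
      have := abs_add_three (tiltWE ρ₂ ⌈β ^ θ⌉₊ J β t - tiltCubicW ρ₂ ⌈β ^ θ⌉₊ β t -
        ∑ e : ColdFreeIdx ⌈β ^ θ⌉₊, Real.log (J (unscaleTE ⌈β ^ θ⌉₊ (dimE ρ₂) β t e))) (tiltCubicW ρ₂ ⌈β ^ θ⌉₊ β t)
        (∑ e : ColdFreeIdx ⌈β ^ θ⌉₊, Real.log (J (unscaleTE ⌈β ^ θ⌉₊ (dimE ρ₂) β t e)))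
      rwa [show tiltWE ρ₂ ⌈β ^ θ⌉₊ J β t - tiltCubicW ρ₂ ⌈β ^ θ⌉₊ β t -
          ∑ e : ColdFreeIdx ⌈β ^ θ⌉₊, Real.log (J (unscaleTE ⌈β ^ θ⌉₊ (dimE ρ₂) β t e)) + tiltCubicW ρ₂ ⌈β ^ θ⌉₊ β t +
          ∑ e : ColdFreeIdx ⌈β ^ θ⌉₊, Real.log (J (unscaleTE ⌈β ^ θ⌉₊ (dimE ρ₂) β t e)) = tiltWE ρ₂ ⌈β ^ θ⌉₊ J β t by ring] at this
    linarith
  -- the tilt is bounded on the event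
  have hM₁ : ∀ t ∈ lineEvent θ β, |tiltCubicW ρ₂ ⌈β ^ θ⌉₊ β t| ≤
      24 * (#(plaquettesTouching (AxialGauge.boxEdges 4 (2 * ⌈β ^ θ⌉₊ + 1))) : ℝ) * β * (2 * etaOf β ⌈β ^ θ⌉₊ (epsOf θ)) ^ 3 :=
    fun t ht => abs_tiltCubicW_le_of_ball ρ₂ hβ0.le hR0 t (hES t ht)
  have hM₂ : ∀ t ∈ lineEvent θ β, 13440 * β * ∑ e : ColdFreeIdx ⌈β ^ θ⌉₊, ‖unscaleTE ⌈β ^ θ⌉₊ (dimE ρ₂) β t e‖ ^ 4 ≤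
      13440 * β * ((Fintype.card (ColdFreeIdx ⌈β ^ θ⌉₊) : ℝ) * (2 * etaOf β ⌈β ^ θ⌉₊ (epsOf θ)) ^ 4) :=
    fun t ht => quartic_dominator_le_of_ball hβ0.le t (hES t ht)
  have hM₃ : ∀ t ∈ lineEvent θ β, 2 * C₂ * ∑ e : ColdFreeIdx ⌈β ^ θ⌉₊, ‖unscaleTE ⌈β ^ θ⌉₊ (dimE ρ₂) β t e‖ ^ 2 ≤
      2 * C₂ * ((Fintype.card (ColdFreeIdx ⌈β ^ θ⌉₊) : ℝ) * (2 * etaOf β ⌈β ^ θ⌉₊ (epsOf θ)) ^ 2) :=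
    fun t ht => quadratic_dominator_le_of_ball hC₂.le t (hES t ht)
  obtain ⟨Mtot, hMtot⟩ : ∃ M : ℝ, 24 * (#(plaquettesTouching (AxialGauge.boxEdges 4 (2 * ⌈β ^ θ⌉₊ + 1))) : ℝ) * β *
      (2 * etaOf β ⌈β ^ θ⌉₊ (epsOf θ)) ^ 3 + 13440 * β * ((Fintype.card (ColdFreeIdx ⌈β ^ θ⌉₊) : ℝ) *
      (2 * etaOf β ⌈β ^ θ⌉₊ (epsOf θ)) ^ 4) + 2 * C₂ * ((Fintype.card (ColdFreeIdx ⌈β ^ θ⌉₊) : ℝ) *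
      (2 * etaOf β ⌈β ^ θ⌉₊ (epsOf θ)) ^ 2) = M := ⟨_, rfl⟩
  have hTbd : ∀ t ∈ lineEvent θ β, |tiltWE ρ₂ ⌈β ^ θ⌉₊ J β t| ≤ Mtot := by
    intro t ht
    linarith [hdec t ht, hM₁ t ht, hM₂ t ht, hM₃ t ht]
  have hMtot0 : 0 ≤ Mtot := by
    rw [← hMtot]
    have hNP0 : (0 : ℝ) ≤ (#(plaquettesTouching (AxialGauge.boxEdges 4 (2 * ⌈β ^ θ⌉₊ + 1))) : ℝ) := Nat.cast_nonneg _
    have hNE0 : (0 : ℝ) ≤ (Fintype.card (ColdFreeIdx ⌈β ^ θ⌉₊) : ℝ) := Nat.cast_nonneg _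
    exact add_nonneg (add_nonneg (mul_nonneg (mul_nonneg (mul_nonneg (by norm_num) hNP0) hβ0.le) (pow_nonneg hR0 3))
      (mul_nonneg (mul_nonneg (by norm_num) hβ0.le) (mul_nonneg hNE0 (pow_nonneg hR0 4))))
      (mul_nonneg (mul_nonneg (by norm_num) hC₂.le) (mul_nonneg hNE0 (pow_nonneg hR0 2)))
  -- `ν`-a.e. the point lies in the event; `T` and `W` are bounded under `ν`
  have haeE : ∀ᵐ t ∂(lineGauss θ β), t ∈ lineEvent θ β := ae_mem_lineEvent θ β
  have hTae : ∀ᵐ t ∂(lineGauss θ β), ‖tiltWE ρ₂ ⌈β ^ θ⌉₊ J β t‖ ≤ Mtot :=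
    haeE.mono fun t ht => by rw [Real.norm_eq_abs]; exact hTbd t ht
  have hTint : Integrable (tiltWE ρ₂ ⌈β ^ θ⌉₊ J β) (lineGauss θ β) := Integrable.of_bound hTm.aestronglyMeasurable Mtot hTae
  have hT8int : Integrable (fun t => tiltWE ρ₂ ⌈β ^ θ⌉₊ J β t ^ 8) (lineGauss θ β) := by
    refine Integrable.of_bound (hTm.pow_const 8).aestronglyMeasurable (Mtot ^ 8) (hTae.mono fun t ht => ?_)
    rw [Real.norm_eq_abs] at ht ⊢
    rw [abs_pow]
    exact pow_le_pow_left₀ (abs_nonneg _) ht 8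
  -- Jensen: `c⁸ ≤ ∫ T⁸ dν`
  have hJensen : (∫ t, tiltWE ρ₂ ⌈β ^ θ⌉₊ J β t ∂(lineGauss θ β)) ^ 8 ≤ ∫ t, tiltWE ρ₂ ⌈β ^ θ⌉₊ J β t ^ 8 ∂(lineGauss θ β) :=
    (Even.convexOn_pow (by decide : Even 8)).map_integral_le (continuousOn_pow 8) isClosed_univ
      (ae_of_all _ fun _ => Set.mem_univ _) hTint hT8int
  -- `∫ W⁸ dν ≤ 2⁸ ∫ T⁸ dν`
  have hW8 : ∫ t, centredTilt θ β J t ^ 8 ∂(lineGauss θ β) ≤ 2 ^ 8 * ∫ t, tiltWE ρ₂ ⌈β ^ θ⌉₊ J β t ^ 8 ∂(lineGauss θ β) := by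
    have hpt : ∀ t, centredTilt θ β J t ^ 8 ≤ 2 ^ 7 * (tiltWE ρ₂ ⌈β ^ θ⌉₊ J β t ^ 8 +
        (∫ s, tiltWE ρ₂ ⌈β ^ θ⌉₊ J β s ∂(lineGauss θ β)) ^ 8) := fun t => sub_pow_eight_le _ _
    have hRint : Integrable (fun t => 2 ^ 7 * (tiltWE ρ₂ ⌈β ^ θ⌉₊ J β t ^ 8 +
        (∫ s, tiltWE ρ₂ ⌈β ^ θ⌉₊ J β s ∂(lineGauss θ β)) ^ 8)) (lineGauss θ β) :=
      (hT8int.add (integrable_const _)).const_mul _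
    have hWint : Integrable (fun t => centredTilt θ β J t ^ 8) (lineGauss θ β) := by
      refine Integrable.mono' hRint ?_ (ae_of_all _ fun t => ?_)
      · have : centredTilt θ β J = fun t => tiltWE ρ₂ ⌈β ^ θ⌉₊ J β t - ∫ s, tiltWE ρ₂ ⌈β ^ θ⌉₊ J β s ∂(lineGauss θ β) := rfl
        rw [this]
        exact ((hTm.sub measurable_const).pow_const 8).aestronglyMeasurable
      · rw [Real.norm_eq_abs, abs_of_nonneg (by positivity)]
        exact hpt t
    calc ∫ t, centredTilt θ β J t ^ 8 ∂(lineGauss θ β)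
        ≤ ∫ t, 2 ^ 7 * (tiltWE ρ₂ ⌈β ^ θ⌉₊ J β t ^ 8 + (∫ s, tiltWE ρ₂ ⌈β ^ θ⌉₊ J β s ∂(lineGauss θ β)) ^ 8) ∂(lineGauss θ β) :=
          integral_mono hWint hRint hpt
      _ = 2 ^ 7 * (∫ t, tiltWE ρ₂ ⌈β ^ θ⌉₊ J β t ^ 8 ∂(lineGauss θ β) + (∫ s, tiltWE ρ₂ ⌈β ^ θ⌉₊ J β s ∂(lineGauss θ β)) ^ 8) := by
          rw [integral_const_mul, integral_add hT8int (integrable_const _), integral_const, probReal_univ, one_smul]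
      _ ≤ 2 ^ 8 * ∫ t, tiltWE ρ₂ ⌈β ^ θ⌉₊ J β t ^ 8 ∂(lineGauss θ β) := by linarith [hJensen]
  -- `∫ T⁸ dν ≤ ∫ G8 dν ≤ 2 ∫ G8 dγ`, `G8 = 3⁷(X₁⁸ + X₂⁸ + X₃⁸)`
  have hG8γ : Integrable (fun t : TSpaceD ⌈β ^ θ⌉₊ (dimE ρ₂) => 3 ^ 7 * (tiltCubicW ρ₂ ⌈β ^ θ⌉₊ β t ^ 8 +
      (13440 * β * ∑ e : ColdFreeIdx ⌈β ^ θ⌉₊, ‖unscaleTE ⌈β ^ θ⌉₊ (dimE ρ₂) β t e‖ ^ 4) ^ 8 +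
      (2 * C₂ * ∑ e : ColdFreeIdx ⌈β ^ θ⌉₊, ‖unscaleTE ⌈β ^ θ⌉₊ (dimE ρ₂) β t e‖ ^ 2) ^ 8)) (gaussD ⌈β ^ θ⌉₊ (dimE ρ₂)) := by
    have h1 : Integrable (fun t : TSpaceD ⌈β ^ θ⌉₊ (dimE ρ₂) => tiltCubicW ρ₂ ⌈β ^ θ⌉₊ β t ^ 8) (gaussD ⌈β ^ θ⌉₊ (dimE ρ₂)) :=
      hint₁ 4
    have h2 := integrable_sum_norm_unscaleTE_pow_four_pow (H := ⌈β ^ θ⌉₊) (D := dimE ρ₂) hβ0.le (13440 * β) 8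
    have h3 := integrable_sum_norm_unscaleTE_sq_pow (H := ⌈β ^ θ⌉₊) (D := dimE ρ₂) hβ0.le (2 * C₂) 8
    have h12 : Integrable (fun t : TSpaceD ⌈β ^ θ⌉₊ (dimE ρ₂) => tiltCubicW ρ₂ ⌈β ^ θ⌉₊ β t ^ 8 +
        (13440 * β * ∑ e : ColdFreeIdx ⌈β ^ θ⌉₊, ‖unscaleTE ⌈β ^ θ⌉₊ (dimE ρ₂) β t e‖ ^ 4) ^ 8) (gaussD ⌈β ^ θ⌉₊ (dimE ρ₂)) :=
      h1.add h2
    have h123 : Integrable (fun t : TSpaceD ⌈β ^ θ⌉₊ (dimE ρ₂) => tiltCubicW ρ₂ ⌈β ^ θ⌉₊ β t ^ 8 +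
        (13440 * β * ∑ e : ColdFreeIdx ⌈β ^ θ⌉₊, ‖unscaleTE ⌈β ^ θ⌉₊ (dimE ρ₂) β t e‖ ^ 4) ^ 8 +
        (2 * C₂ * ∑ e : ColdFreeIdx ⌈β ^ θ⌉₊, ‖unscaleTE ⌈β ^ θ⌉₊ (dimE ρ₂) β t e‖ ^ 2) ^ 8) (gaussD ⌈β ^ θ⌉₊ (dimE ρ₂)) :=
      h12.add h3
    exact h123.const_mul _
  have hG8ν : Integrable (fun t : TSpaceD ⌈β ^ θ⌉₊ (dimE ρ₂) => 3 ^ 7 * (tiltCubicW ρ₂ ⌈β ^ θ⌉₊ β t ^ 8 +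
      (13440 * β * ∑ e : ColdFreeIdx ⌈β ^ θ⌉₊, ‖unscaleTE ⌈β ^ θ⌉₊ (dimE ρ₂) β t e‖ ^ 4) ^ 8 +
      (2 * C₂ * ∑ e : ColdFreeIdx ⌈β ^ θ⌉₊, ‖unscaleTE ⌈β ^ θ⌉₊ (dimE ρ₂) β t e‖ ^ 2) ^ 8)) (lineGauss θ β) :=
    integrable_cond_of_integrable hγS hG8γ
  have hG80 : ∀ t : TSpaceD ⌈β ^ θ⌉₊ (dimE ρ₂), 0 ≤ 3 ^ 7 * (tiltCubicW ρ₂ ⌈β ^ θ⌉₊ β t ^ 8 +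
      (13440 * β * ∑ e : ColdFreeIdx ⌈β ^ θ⌉₊, ‖unscaleTE ⌈β ^ θ⌉₊ (dimE ρ₂) β t e‖ ^ 4) ^ 8 +
      (2 * C₂ * ∑ e : ColdFreeIdx ⌈β ^ θ⌉₊, ‖unscaleTE ⌈β ^ θ⌉₊ (dimE ρ₂) β t e‖ ^ 2) ^ 8) := fun t =>
    mul_nonneg (by norm_num) (add_nonneg (add_nonneg (Even.pow_nonneg (by decide) _) (Even.pow_nonneg (by decide) _))
      (Even.pow_nonneg (by decide) _))
  have hT8le : ∫ t, tiltWE ρ₂ ⌈β ^ θ⌉₊ J β t ^ 8 ∂(lineGauss θ β) ≤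
      ∫ t, 3 ^ 7 * (tiltCubicW ρ₂ ⌈β ^ θ⌉₊ β t ^ 8 +
        (13440 * β * ∑ e : ColdFreeIdx ⌈β ^ θ⌉₊, ‖unscaleTE ⌈β ^ θ⌉₊ (dimE ρ₂) β t e‖ ^ 4) ^ 8 +
        (2 * C₂ * ∑ e : ColdFreeIdx ⌈β ^ θ⌉₊, ‖unscaleTE ⌈β ^ θ⌉₊ (dimE ρ₂) β t e‖ ^ 2) ^ 8) ∂(lineGauss θ β) := by
    refine integral_mono_ae hT8int hG8ν (haeE.mono fun t ht => ?_)
    have hd := hdec t ht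
    have hX₂0 : 0 ≤ 13440 * β * ∑ e : ColdFreeIdx ⌈β ^ θ⌉₊, ‖unscaleTE ⌈β ^ θ⌉₊ (dimE ρ₂) β t e‖ ^ 4 :=
      mul_nonneg (mul_nonneg (by norm_num) hβ0.le) (Finset.sum_nonneg fun e _ => pow_nonneg (norm_nonneg _) 4)
    have hX₃0 : 0 ≤ 2 * C₂ * ∑ e : ColdFreeIdx ⌈β ^ θ⌉₊, ‖unscaleTE ⌈β ^ θ⌉₊ (dimE ρ₂) β t e‖ ^ 2 :=
      mul_nonneg (mul_nonneg (by norm_num) hC₂.le) (Finset.sum_nonneg fun e _ => pow_nonneg (norm_nonneg _) 2)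
    have h3 := add_add_pow_eight_le (abs_nonneg (tiltCubicW ρ₂ ⌈β ^ θ⌉₊ β t)) hX₂0 hX₃0
    rw [pow_abs, show |tiltCubicW ρ₂ ⌈β ^ θ⌉₊ β t ^ 8| = tiltCubicW ρ₂ ⌈β ^ θ⌉₊ β t ^ 8 from abs_of_nonneg (by positivity)] at h3
    calc tiltWE ρ₂ ⌈β ^ θ⌉₊ J β t ^ 8 = |tiltWE ρ₂ ⌈β ^ θ⌉₊ J β t| ^ 8 := by rw [pow_abs, abs_of_nonneg (by positivity)]
      _ ≤ (|tiltCubicW ρ₂ ⌈β ^ θ⌉₊ β t| + 13440 * β * ∑ e : ColdFreeIdx ⌈β ^ θ⌉₊, ‖unscaleTE ⌈β ^ θ⌉₊ (dimE ρ₂) β t e‖ ^ 4 +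
          2 * C₂ * ∑ e : ColdFreeIdx ⌈β ^ θ⌉₊, ‖unscaleTE ⌈β ^ θ⌉₊ (dimE ρ₂) β t e‖ ^ 2) ^ 8 :=
          pow_le_pow_left₀ (abs_nonneg _) hd 8
      _ ≤ _ := h3
  have hG8two := integral_cond_le_two_mul (μ := gaussD ⌈β ^ θ⌉₊ (dimE ρ₂)) (E := lineEvent θ β) hhalf (ae_of_all _ hG80) hG8γ
  -- the Gaussian moments at `k = 4`
  have hI₁ : ∫ t, tiltCubicW ρ₂ ⌈β ^ θ⌉₊ β t ^ 8 ∂(gaussD ⌈β ^ θ⌉₊ (dimE ρ₂)) ≤ 7 ^ 12 * (K₁ * (2 * (⌈β ^ θ⌉₊ : ℝ) + 3) ^ 6 / β) ^ 4 := by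
    have h := hmom₁ 4 (by norm_num)
    have e1 : ((2 : ℝ) * ((4 : ℕ) : ℝ) - 1) ^ (4 * 3) = 7 ^ 12 := by norm_num
    rw [e1] at h
    exact h
  have hI₂ : ∫ t, (13440 * β * ∑ e : ColdFreeIdx ⌈β ^ θ⌉₊, ‖unscaleTE ⌈β ^ θ⌉₊ (dimE ρ₂) β t e‖ ^ 4) ^ 8
      ∂(gaussD ⌈β ^ θ⌉₊ (dimE ρ₂)) ≤ 7 ^ 16 * ((⌈β ^ θ⌉₊ : ℝ) ^ 6 / β) ^ 4 := by
    have h := integral_sum_norm_unscaleTE_pow_four_pow_le (H := ⌈β ^ θ⌉₊) (D := dimE ρ₂) hβ0.le (13440 * β) 4 (by norm_num)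
    have hs := (integral_sq_quartic_dominator_le (D := dimE ρ₂) hH hβ0 (13440 * β)).trans hŝ₂
    have hs0 : 0 ≤ ∫ t, (13440 * β * ∑ e : ColdFreeIdx ⌈β ^ θ⌉₊, ‖unscaleTE ⌈β ^ θ⌉₊ (dimE ρ₂) β t e‖ ^ 4) ^ 2
        ∂(gaussD ⌈β ^ θ⌉₊ (dimE ρ₂)) := integral_nonneg fun t => sq_nonneg _
    have e1 : ((2 : ℝ) * ((4 : ℕ) : ℝ) - 1) ^ (4 * 4) = 7 ^ 16 := by norm_num
    rw [e1] at h
    exact h.trans (mul_le_mul_of_nonneg_left (pow_le_pow_left₀ hs0 hs 4) (by norm_num))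
  have hI₃ : ∫ t, (2 * C₂ * ∑ e : ColdFreeIdx ⌈β ^ θ⌉₊, ‖unscaleTE ⌈β ^ θ⌉₊ (dimE ρ₂) β t e‖ ^ 2) ^ 8
      ∂(gaussD ⌈β ^ θ⌉₊ (dimE ρ₂)) ≤ 7 ^ 8 * ((⌈β ^ θ⌉₊ : ℝ) ^ 6 / β) ^ 4 := by
    have h := integral_sum_norm_unscaleTE_sq_pow_le (H := ⌈β ^ θ⌉₊) (D := dimE ρ₂) hβ0.le (2 * C₂) 4 (by norm_num)
    have hs := (integral_sq_quadratic_dominator_le (D := dimE ρ₂) hH hβ0 (2 * C₂)).trans hŝ₃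
    have hs0 : 0 ≤ ∫ t, (2 * C₂ * ∑ e : ColdFreeIdx ⌈β ^ θ⌉₊, ‖unscaleTE ⌈β ^ θ⌉₊ (dimE ρ₂) β t e‖ ^ 2) ^ 2
        ∂(gaussD ⌈β ^ θ⌉₊ (dimE ρ₂)) := integral_nonneg fun t => sq_nonneg _
    have e1 : ((2 : ℝ) * ((4 : ℕ) : ℝ) - 1) ^ (4 * 2) = 7 ^ 8 := by norm_num
    rw [e1] at h
    exact h.trans (mul_le_mul_of_nonneg_left (pow_le_pow_left₀ hs0 hs 4) (by norm_num))
  have hG8γ_le : ∫ t, 3 ^ 7 * (tiltCubicW ρ₂ ⌈β ^ θ⌉₊ β t ^ 8 +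
      (13440 * β * ∑ e : ColdFreeIdx ⌈β ^ θ⌉₊, ‖unscaleTE ⌈β ^ θ⌉₊ (dimE ρ₂) β t e‖ ^ 4) ^ 8 +
      (2 * C₂ * ∑ e : ColdFreeIdx ⌈β ^ θ⌉₊, ‖unscaleTE ⌈β ^ θ⌉₊ (dimE ρ₂) β t e‖ ^ 2) ^ 8) ∂(gaussD ⌈β ^ θ⌉₊ (dimE ρ₂)) ≤
      3 ^ 7 * (7 ^ 12 * (15625 * K₁ * ((⌈β ^ θ⌉₊ : ℝ) ^ 6 / β)) ^ 4 + 7 ^ 16 * ((⌈β ^ θ⌉₊ : ℝ) ^ 6 / β) ^ 4 +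
        7 ^ 8 * ((⌈β ^ θ⌉₊ : ℝ) ^ 6 / β) ^ 4) := by
    have h1 : Integrable (fun t : TSpaceD ⌈β ^ θ⌉₊ (dimE ρ₂) => tiltCubicW ρ₂ ⌈β ^ θ⌉₊ β t ^ 8) (gaussD ⌈β ^ θ⌉₊ (dimE ρ₂)) :=
      hint₁ 4
    have h2 := integrable_sum_norm_unscaleTE_pow_four_pow (H := ⌈β ^ θ⌉₊) (D := dimE ρ₂) hβ0.le (13440 * β) 8
    have h3 := integrable_sum_norm_unscaleTE_sq_pow (H := ⌈β ^ θ⌉₊) (D := dimE ρ₂) hβ0.le (2 * C₂) 8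
    have h12 : Integrable (fun t : TSpaceD ⌈β ^ θ⌉₊ (dimE ρ₂) => tiltCubicW ρ₂ ⌈β ^ θ⌉₊ β t ^ 8 +
        (13440 * β * ∑ e : ColdFreeIdx ⌈β ^ θ⌉₊, ‖unscaleTE ⌈β ^ θ⌉₊ (dimE ρ₂) β t e‖ ^ 4) ^ 8) (gaussD ⌈β ^ θ⌉₊ (dimE ρ₂)) :=
      h1.add h2
    have e12 := integral_add h1 h2
    have e123 := integral_add h12 h3
    rw [integral_const_mul, e123, e12]
    have hK4 : (K₁ * (2 * (⌈β ^ θ⌉₊ : ℝ) + 3) ^ 6 / β) ^ 4 ≤ (15625 * K₁ * ((⌈β ^ θ⌉₊ : ℝ) ^ 6 / β)) ^ 4 :=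
      pow_le_pow_left₀ hs₁0 hs₁ 4
    linarith [hI₁, hI₂, hI₃, hK4]
  -- combine: `∫ W⁸ dν ≤ (10⁹(K₁+1)·H⁶/β)⁴`
  have hW8le : ∫ t, centredTilt θ β J t ^ 8 ∂(lineGauss θ β) ≤ (10 ^ 9 * (K₁ + 1) * ((⌈β ^ θ⌉₊ : ℝ) ^ 6 / β)) ^ 4 := by
    have hchain : ∫ t, centredTilt θ β J t ^ 8 ∂(lineGauss θ β) ≤ 2 ^ 8 * (2 * (3 ^ 7 * (7 ^ 12 * (15625 * K₁ *
        ((⌈β ^ θ⌉₊ : ℝ) ^ 6 / β)) ^ 4 + 7 ^ 16 * ((⌈β ^ θ⌉₊ : ℝ) ^ 6 / β) ^ 4 + 7 ^ 8 * ((⌈β ^ θ⌉₊ : ℝ) ^ 6 / β) ^ 4))) := by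
      have := hT8le.trans (hG8two.trans (mul_le_mul_of_nonneg_left hG8γ_le (by norm_num)))
      linarith [hW8]
    refine hchain.trans ?_
    have hK4 : K₁ ^ 4 ≤ (K₁ + 1) ^ 4 := pow_le_pow_left₀ hK₁ (by linarith) 4
    have h14 : 1 ≤ (K₁ + 1) ^ 4 := one_le_pow₀ (by linarith)
    have hu4 : 0 ≤ ((⌈β ^ θ⌉₊ : ℝ) ^ 6 / β) ^ 4 := pow_nonneg hu0 4
    have hcoef : 2 ^ 8 * (2 * (3 ^ 7 * (7 ^ 12 * 15625 ^ 4 * K₁ ^ 4 + 7 ^ 16 + 7 ^ 8))) ≤ (10 ^ 9 * (K₁ + 1)) ^ 4 := by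
      nlinarith
    calc 2 ^ 8 * (2 * (3 ^ 7 * (7 ^ 12 * (15625 * K₁ * ((⌈β ^ θ⌉₊ : ℝ) ^ 6 / β)) ^ 4 + 7 ^ 16 * ((⌈β ^ θ⌉₊ : ℝ) ^ 6 / β) ^ 4 +
          7 ^ 8 * ((⌈β ^ θ⌉₊ : ℝ) ^ 6 / β) ^ 4)))
        = 2 ^ 8 * (2 * (3 ^ 7 * (7 ^ 12 * 15625 ^ 4 * K₁ ^ 4 + 7 ^ 16 + 7 ^ 8))) * ((⌈β ^ θ⌉₊ : ℝ) ^ 6 / β) ^ 4 := by ring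
      _ ≤ (10 ^ 9 * (K₁ + 1)) ^ 4 * ((⌈β ^ θ⌉₊ : ℝ) ^ 6 / β) ^ 4 := mul_le_mul_of_nonneg_right hcoef hu4
      _ = (10 ^ 9 * (K₁ + 1) * ((⌈β ^ θ⌉₊ : ℝ) ^ 6 / β)) ^ 4 := by ring
  -- take fourth roots
  have hKu0 : 0 ≤ 10 ^ 9 * (K₁ + 1) * ((⌈β ^ θ⌉₊ : ℝ) ^ 6 / β) := by positivity
  have hI0 : 0 ≤ ∫ t, centredTilt θ β J t ^ 8 ∂(lineGauss θ β) := integral_nonneg fun t => by positivity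
  calc (∫ t, centredTilt θ β J t ^ 8 ∂(lineGauss θ β)) ^ (1 / 4 : ℝ)
      ≤ ((10 ^ 9 * (K₁ + 1) * ((⌈β ^ θ⌉₊ : ℝ) ^ 6 / β)) ^ 4) ^ (1 / 4 : ℝ) := Real.rpow_le_rpow hI0 hW8le (by norm_num)
    _ = 10 ^ 9 * (K₁ + 1) * ((⌈β ^ θ⌉₊ : ℝ) ^ 6 / β) := by
        rw [show (1 / 4 : ℝ) = ((4 : ℕ) : ℝ)⁻¹ by norm_num]
        exact Real.pow_rpow_inv_natCast hKu0 (by norm_num)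
    _ = 10 ^ 9 * (K₁ + 1) * (⌈β ^ θ⌉₊ : ℝ) ^ 6 / β := (mul_div_assoc _ _ _).symm

/-! ## Both clauses: `TiltMoments θ` from the cubic-chaos input -/

/-- **Stub E of LINE-17 modulo the cubic chaos**: the hypercontractive moment package of `V₃ = tiltCubicW` (E(1)+E(3)+E(5)) implies
`TiltMoments θ` for every `0 < θ ≤ 1/16` (both clauses, `tiltMoments_l8_of_cubic` and `tiltMoments_exp_of_cubic`). -/
theorem tiltMoments_of_cubic
    (hV : ∃ K₁ : ℝ, 0 ≤ K₁ ∧ ∀ (H : ℕ) (β : ℝ), 1 ≤ H → 1 ≤ β →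
      (∀ k : ℕ, 1 ≤ k → ∫ t, tiltCubicW ρ₂ H β t ^ (2 * k) ∂(gaussD H (dimE ρ₂)) ≤
          (2 * k - 1 : ℝ) ^ (k * 3) * (K₁ * (2 * (H : ℝ) + 3) ^ 6 / β) ^ k) ∧
      (∀ k : ℕ, Integrable (fun t => tiltCubicW ρ₂ H β t ^ (2 * k)) (gaussD H (dimE ρ₂))))
    (θ : ℝ) (hθ : 0 < θ) (hθ16 : θ ≤ 1 / 16) : TiltMoments θ := by
  intro r₂ C₂ J hJ
  obtain ⟨⟨K, β₁, hK, h1⟩, ⟨β₂, h2⟩⟩ := And.intro (tiltMoments_l8_of_cubic hV hθ hθ16 hJ) (tiltMoments_exp_of_cubic hV hθ hθ16 hJ)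
  exact ⟨K, max β₁ β₂, hK, fun β hβ => ⟨h1 β ((le_max_left _ _).trans hβ), h2 β ((le_max_right _ _).trans hβ)⟩⟩

end Summit.QuantumFields.YangMills.Theorems.AllWindowsColdBoxBoxMidLine

end
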